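import Summits.Langlands.Langlands.Theses.ExteriorSquareAscent
import Literature.NumberTheory.GaloisRepresentations.GaloisRep

/-!
# Stub `stub_planesBlocks` of line `Sketch` for crux stmt-Langlands-18054
(`Summit.Langlands.Langlands.Theses.ExteriorSquareAscent.ReducibleInducesSquare`)

Pure linear algebra and continuity: two complementary `Γ_K`-stable planes `W₁ ⊕ W₂ = ℚ̄_ℓ⁴` of a
framed continuous representation `ρ : Γ_K →ₜ* GL₄(ℚ̄_ℓ)` put `ρ` in block form `diag(S, T)`.

For a stable subspace `W` of a framed continuous representation `r : G →ₜ* GL_n(A)` (`A` a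
topological field) with a chosen basis `b`, the matrices `g ↦ [r(g)|_W]_b` form a framed
continuous representation (`exists_framedRep_coe_eq_toMatrix`): the `(i, j)` entry is
`φᵢ (r(g) b_j)` for a linear form `φᵢ` on `Aⁿ` extending the `i`-th coordinate form of `b`
(`LinearMap.exists_extend`), hence continuous in `g` (`LinearMap.continuous_on_pi`); the inverse is
the value at `g⁻¹` (`MonoidHom.toHomUnits`, `Units.continuous_iff`).  For complementary stable
`W₁, W₂`, `r(g)` is conjugate (`Submodule.prodEquivOfIsCompl`) to `r(g)|_{W₁} × r(g)|_{W₂}`, so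
`charpoly r(g) = charpoly [r(g)|_{W₁}] · charpoly [r(g)|_{W₂}]` (`LinearEquiv.charpoly_conj`,
`LinearMap.charpoly_prodMap`, `LinearMap.charpoly_toMatrix`, `Matrix.charpoly_toLin'`); and
`r(g) = 1` forces both blocks to be `1` (`LinearMap.toMatrix_one`).
-/

set_option linter.dupNamespace false -- `Summit.Langlands.Langlands` is the mandated namespace

noncomputable section

namespace Summit.Langlands.Langlands.Cruxes.ReducibleInducesSquare.Sketch

open Literature.NumberTheory.GaloisRepresentations
open scoped Matrix

/-! ### Blocks of a framed continuous representation on a stable subspace -/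

section Blocks

variable {G : Type*} [Group G] [TopologicalSpace G]
  {A : Type*} [Field A] [TopologicalSpace A] [IsTopologicalRing A] {n : ℕ}

/-- The action of a subrepresentation is the restriction of the ambient action
(Mathlib `Subrepresentation.toRepresentation`, `LinearMap.restrict`). [folklore] -/
theorem coe_toRepresentation_apply {k H V : Type*} [CommSemiring k] [Monoid H] [AddCommMonoid V]
    [Module k V] {σ : Representation k H V} (W : Subrepresentation σ) (g : H)
    (w : W.toSubmodule) : ((W.toRepresentation g w : W.toSubmodule) : V) = σ g w := rfl

/-- **Continuity of the block of a stable subspace.**  For a framed continuous representation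
`r : G →ₜ* GL_n(A)` over a topological field `A`, an `r`-stable subspace `W ≤ Aⁿ` with a basis
`b`, and any `F : X → G` such that `x ↦ r(F x)` is continuous as a matrix-valued map, the matrix of
`r(F x)|_W` in the basis `b` depends continuously on `x`: its `(i, j)` entry is `φᵢ (r(F x) b_j)`
for a linear form `φᵢ` on `Aⁿ` extending the `i`-th coordinate form of `b`
(`LinearMap.exists_extend`), and linear forms on `Aⁿ` are continuous
(`LinearMap.continuous_on_pi`). [folklore] -/
theorem continuous_toMatrix_toRepresentation {X : Type*} [TopologicalSpace X] (r : FramedRep G A n)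
    (W : Subrepresentation r.toContinuousRep.toRepresentation) {ι : Type*} [Fintype ι]
    [DecidableEq ι] (b : Module.Basis ι A W.toSubmodule) (F : X → G)
    (hF : Continuous fun x => ((r (F x) : GL (Fin n) A) : Matrix (Fin n) (Fin n) A)) :
    Continuous fun x => LinearMap.toMatrix b b (W.toRepresentation (F x)) := by
  refine continuous_matrix fun i j => ?_
  obtain ⟨φ, hφ⟩ := LinearMap.exists_extend (b.coord i)
  have hφ' : ∀ w : W.toSubmodule, b.repr w i = φ (w : Fin n → A) := fun w => by
    rw [← b.coord_apply, ← hφ]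
    rfl
  have key : (fun x => LinearMap.toMatrix b b (W.toRepresentation (F x)) i j) = fun x =>
      φ (((r (F x) : GL (Fin n) A) : Matrix (Fin n) (Fin n) A) *ᵥ
        ((b j : W.toSubmodule) : Fin n → A)) := by
    funext x
    rw [LinearMap.toMatrix_apply, hφ']
    rfl
  rw [key]
  exact (LinearMap.continuous_on_pi φ).comp (hF.matrix_mulVec continuous_const)

/-- **The block of a stable subspace is a framed continuous representation.**  For a framed
continuous representation `r : G →ₜ* GL_n(A)` over a topological field `A` and an `r`-stable
subspace `W ≤ Aⁿ` with a basis `b` indexed by `Fin k`, there is a framed continuous representation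
`S : G →ₜ* GL_k(A)` with `S(g) = [r(g)|_W]_b` for all `g`: `g ↦ [r(g)|_W]_b` is a monoid
homomorphism (`LinearMap.toMatrix_one`, `LinearMap.toMatrix_mul`), hence lands in units
(`MonoidHom.toHomUnits`, inverse `[r(g⁻¹)|_W]_b`), and both it and its inverse are continuous
(`continuous_toMatrix_toRepresentation`, `Units.continuous_iff`). [folklore] -/
theorem exists_framedRep_coe_eq_toMatrix (r : FramedRep G A n)
    (W : Subrepresentation r.toContinuousRep.toRepresentation) {k : ℕ}
    (b : Module.Basis (Fin k) A W.toSubmodule) :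
    ∃ S : FramedRep G A k, ∀ g : G,
      ((S g : GL (Fin k) A) : Matrix (Fin k) (Fin k) A) =
        LinearMap.toMatrix b b (W.toRepresentation g) := by
  obtain ⟨S₀, hS₀⟩ : ∃ S₀ : G →* Matrix (Fin k) (Fin k) A,
      ∀ g : G, S₀ g = LinearMap.toMatrix b b (W.toRepresentation g) :=
    ⟨{ toFun := fun g => LinearMap.toMatrix b b (W.toRepresentation g)
       map_one' := by simp only [map_one, LinearMap.toMatrix_one]
       map_mul' := fun g h => by simp only [map_mul, LinearMap.toMatrix_mul] }, fun g => rfl⟩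
  have hval : Continuous fun g => S₀ g := by
    simp only [hS₀]
    exact continuous_toMatrix_toRepresentation r W b (fun g => g)
      (Units.continuous_val.comp (map_continuous r))
  have hinv : Continuous fun g => S₀ g⁻¹ := by
    simp only [hS₀]
    refine continuous_toMatrix_toRepresentation r W b (fun g => g⁻¹) ?_
    simp only [map_inv]
    exact Units.continuous_coe_inv.comp (map_continuous r)
  refine ⟨⟨S₀.toHomUnits, Units.continuous_iff.2 ⟨hval, ?_⟩⟩, fun g => hS₀ g⟩
  show Continuous fun g =>
    (((S₀.toHomUnits g)⁻¹ : (Matrix (Fin k) (Fin k) A)ˣ) : Matrix (Fin k) (Fin k) A)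
  simp only [← map_inv, MonoidHom.coe_toHomUnits]
  exact hinv

/-- **Block form of the characteristic polynomial.**  If `W₁, W₂ ≤ Aⁿ` are complementary
`r`-stable subspaces with bases `b₁, b₂`, then
`charpoly r(g) = charpoly [r(g)|_{W₁}]_{b₁} · charpoly [r(g)|_{W₂}]_{b₂}`: `r(g)` (as the linear
map `Matrix.toLin' (r g)`, `Matrix.charpoly_toLin'`) is conjugate by
`Submodule.prodEquivOfIsCompl W₁ W₂ : W₁ × W₂ ≃ₗ Aⁿ` to `r(g)|_{W₁} × r(g)|_{W₂}`
(`LinearEquiv.charpoly_conj`, `LinearMap.charpoly_prodMap`, `LinearMap.charpoly_toMatrix`).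
[folklore] -/
theorem charpoly_coe_eq_mul_of_isCompl (r : FramedRep G A n)
    {W₁ W₂ : Subrepresentation r.toContinuousRep.toRepresentation} (hc : IsCompl W₁ W₂)
    {ι₁ ι₂ : Type*} [Fintype ι₁] [DecidableEq ι₁] [Fintype ι₂] [DecidableEq ι₂]
    (b₁ : Module.Basis ι₁ A W₁.toSubmodule) (b₂ : Module.Basis ι₂ A W₂.toSubmodule) (g : G) :
    ((r g : GL (Fin n) A) : Matrix (Fin n) (Fin n) A).charpoly =
      (LinearMap.toMatrix b₁ b₁ (W₁.toRepresentation g)).charpoly *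
        (LinearMap.toMatrix b₂ b₂ (W₂.toRepresentation g)).charpoly := by
  haveI := Module.Free.of_basis b₁
  haveI := Module.Finite.of_basis b₁
  haveI := Module.Free.of_basis b₂
  haveI := Module.Finite.of_basis b₂
  have hbot : (⊥ : Subrepresentation r.toContinuousRep.toRepresentation).toSubmodule = ⊥ := rfl
  have htop : (⊤ : Subrepresentation r.toContinuousRep.toRepresentation).toSubmodule = ⊤ := rfl
  have hcW : IsCompl W₁.toSubmodule W₂.toSubmodule := by
    refine IsCompl.of_eq ?_ ?_
    · rw [← Subrepresentation.toSubmodule_inf, hc.inf_eq_bot, hbot]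
    · rw [← Subrepresentation.toSubmodule_sup, hc.sup_eq_top, htop]
  obtain ⟨e, he⟩ : ∃ e : (W₁.toSubmodule × W₂.toSubmodule) ≃ₗ[A] (Fin n → A),
      ∀ p, e p = (p.1 : Fin n → A) + (p.2 : Fin n → A) :=
    ⟨Submodule.prodEquivOfIsCompl _ _ hcW, fun p => rfl⟩
  have hconj : e.conj ((W₁.toRepresentation g).prodMap (W₂.toRepresentation g)) =
      r.toContinuousRep.toRepresentation g := by
    refine LinearMap.ext fun v => ?_
    obtain ⟨p, rfl⟩ := e.surjective v
    rw [LinearEquiv.conj_apply_apply, e.symm_apply_apply, LinearMap.prodMap_apply, he, he, map_add]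
    rfl
  have hlin : Matrix.toLin' ((r g : GL (Fin n) A) : Matrix (Fin n) (Fin n) A) =
      r.toContinuousRep.toRepresentation g :=
    LinearMap.ext fun v => rfl
  rw [← Matrix.charpoly_toLin' ((r g : GL (Fin n) A) : Matrix (Fin n) (Fin n) A), hlin, ← hconj,
    LinearEquiv.charpoly_conj, LinearMap.charpoly_prodMap, LinearMap.charpoly_toMatrix,
    LinearMap.charpoly_toMatrix]

/-- **Trivial where `r` is.**  If `r(g) = 1` then `r(g)|_W = 1` for every `r`-stable subspace `W`
(`Matrix.one_mulVec`). [folklore] -/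
theorem toRepresentation_eq_one_of_eq_one (r : FramedRep G A n)
    (W : Subrepresentation r.toContinuousRep.toRepresentation) {g : G} (hg : r g = 1) :
    W.toRepresentation g = 1 := by
  refine LinearMap.ext fun w => Subtype.ext ?_
  change ((r g : GL (Fin n) A) : Matrix (Fin n) (Fin n) A) *ᵥ (w : Fin n → A) = w
  rw [hg, Units.val_one, Matrix.one_mulVec]

end Blocks

/-! ### The stub -/

/-- **STUB B — two complementary stable planes put `ρ` in block form (linear algebra).** If
`W₁ ⊕ W₂ = ℚ̄_ℓ⁴` are complementary `Γ_K`-stable planes of `ρ : Γ_K → GL₄(ℚ̄_ℓ)`, there are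
continuous `S, T : Γ_K → GL₂(ℚ̄_ℓ)` (the actions on `W₁`, `W₂` in chosen bases,
`Module.finBasisOfFinrankEq`, `exists_framedRep_coe_eq_toMatrix`) with
`charpoly ρ(g) = charpoly S(g) · charpoly T(g)` for every `g` (`charpoly_coe_eq_mul_of_isCompl`)
and `S(g) = T(g) = 1` whenever `ρ(g) = 1` (`toRepresentation_eq_one_of_eq_one`,
`LinearMap.toMatrix_one`). [folklore] -/
theorem stub_planesBlocks :
    ∀ (K : Type) [Field K] [NumberField K] (ℓ : ℕ) [Fact ℓ.Prime]
      (ρ : Literature.NumberTheory.GaloisRepresentations.FramedGaloisRep K (PadicAlgCl ℓ) 4)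
      (W₁ W₂ : Subrepresentation ρ.toGaloisRep.toRepresentation), IsCompl W₁ W₂ →
      Module.finrank (PadicAlgCl ℓ) W₁.toSubmodule = 2 →
      Module.finrank (PadicAlgCl ℓ) W₂.toSubmodule = 2 →
      ∃ S T : Literature.NumberTheory.GaloisRepresentations.FramedGaloisRep K (PadicAlgCl ℓ) 2,
        (∀ g : Field.absoluteGaloisGroup K,
          Literature.NumberTheory.GaloisRepresentations.FramedRep.charpoly ρ g =
            Literature.NumberTheory.GaloisRepresentations.FramedRep.charpoly S g *
              Literature.NumberTheory.GaloisRepresentations.FramedRep.charpoly T g) ∧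
        (∀ g : Field.absoluteGaloisGroup K, ρ g = 1 → S g = 1 ∧ T g = 1) := by
  intro K _ _ ℓ _ ρ W₁ W₂ hc h1 h2
  obtain ⟨S, hS⟩ := exists_framedRep_coe_eq_toMatrix ρ W₁
    (Module.finBasisOfFinrankEq (PadicAlgCl ℓ) W₁.toSubmodule h1)
  obtain ⟨T, hT⟩ := exists_framedRep_coe_eq_toMatrix ρ W₂
    (Module.finBasisOfFinrankEq (PadicAlgCl ℓ) W₂.toSubmodule h2)
  refine ⟨S, T, fun g => ?_, fun g hg => ⟨Units.ext ?_, Units.ext ?_⟩⟩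
  · simp only [FramedRep.charpoly, hS, hT]
    exact charpoly_coe_eq_mul_of_isCompl ρ hc _ _ g
  · rw [hS, toRepresentation_eq_one_of_eq_one ρ W₁ hg, LinearMap.toMatrix_one, Units.val_one]
  · rw [hT, toRepresentation_eq_one_of_eq_one ρ W₂ hg, LinearMap.toMatrix_one, Units.val_one]

end Summit.Langlands.Langlands.Cruxes.ReducibleInducesSquare.Sketch

end
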